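import Mathlib
import Summits.Ventures.PercRepro2.FibreReimer

/-!
# Every source of the `i = 0` row has `j+1` distinct targets below it
(seat mine-b, cell pub-perc-repro2; conjectures/MINE-B.md §17.2 / §18)

Pattern `(O, Y)` (pins `O` open in both colours, free edges `Y` split blue `γ` / red `Y ∖ γ`), terminals
`s`, `t`.  The row STEP(0, j+1) compares the **sources** `{F_R = 0 ∧ F_B ≥ j+1}` with the **targets**
`{F_R = 1 ∧ F_B ≥ j}`; the SUBSET relation `γ' ⊆ γ` is the lane's Hall relation of record for the
`(j+1)`-fold matching behind QSTEP's `i = 0` row `H(1, j) ≥ (j+1)·H(0, j+1)` (MINE-B.md §17.2).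

**`source_has_succ_targets`** is its singleton case: a source has at least `j+1` distinct targets
below it.  Relay: the red cluster `S` of `s` (in `O ∪ (Y ∖ γ)`) has an all-blue, pin-free boundary;
each of the `j+1` disjoint blue `s–t` witnesses leaves `S` through a crossing edge `e_i` and continues
outside `S` to `t` (`exists_crossing_of_carries`); handing that tail `τ_i` to red gives `γ ∖ τ_i`:
red now carries `s ⇝ S ⇝ e_i ⇝ t` and crosses `S` only at `e_i` (`F_R = 1`), the other `j` witnesses
stay blue (`F_B ≥ j`), and the `j+1` configurations are distinct because `e_i` is red in exactly the
`i`-th one.  The bookkeeping lemmas `family_of_kDisj` / `kDisj_of_family` convert the nested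
`kDisj` witnesses into an indexed family of pairwise disjoint witnesses and back.
-/

open Finset

namespace Summit.Ventures.PercRepro2

namespace StepZero

open ReimerCube

variable {V : Type*} {E : Type*} [DecidableEq E]

/-- `k` pairwise disjoint up-witnesses of `A` inside `X`, indexed by `Fin k`, give `kDisj A k X`. -/
lemma kDisj_of_family (A : Finset E → Prop) :
    ∀ (k : ℕ) (X : Finset E) (f : Fin k → Finset E), (∀ i, f i ⊆ X) →
      (∀ i, ∀ T, f i ⊆ T → A T) → (∀ i i', i ≠ i' → Disjoint (f i) (f i')) → kDisj A k X
  | 0, _, _, _, _, _ => trivial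
  | k + 1, X, f, hX, hA, hdisj => by
    refine ⟨f 0, Finset.univ.biUnion (fun i : Fin k => f i.succ), hX 0, ?_, ?_, hA 0, ?_⟩
    · exact Finset.biUnion_subset.2 (fun i _ => hX i.succ)
    · rw [Finset.disjoint_biUnion_right]
      intro i _
      exact hdisj 0 i.succ (Fin.succ_ne_zero i).symm
    · intro T hT
      exact kDisj_of_family A k T (fun i => f i.succ)
        (fun i => (Finset.subset_biUnion_of_mem (fun i : Fin k => f i.succ)
          (Finset.mem_univ i)).trans hT)
        (fun i => hA i.succ)
        (fun i i' h => hdisj i.succ i'.succ (fun h' => h (Fin.succ_injective _ h')))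

omit [DecidableEq E] in
/-- `kDisj A k X` gives `k` pairwise disjoint up-witnesses of `A` inside `X`, indexed by `Fin k`. -/
lemma family_of_kDisj (A : Finset E → Prop) :
    ∀ (k : ℕ) (X : Finset E), kDisj A k X → ∃ f : Fin k → Finset E, (∀ i, f i ⊆ X) ∧
      (∀ i, ∀ T, f i ⊆ T → A T) ∧ (∀ i i', i ≠ i' → Disjoint (f i) (f i'))
  | 0, _, _ => ⟨fun i => Fin.elim0 i, fun i => Fin.elim0 i, fun i => Fin.elim0 i,
      fun i => Fin.elim0 i⟩
  | k + 1, X, h => by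
    obtain ⟨K, L, hK, hL, hKL, hA, hrest⟩ := h
    obtain ⟨g, hg1, hg2, hg3⟩ := family_of_kDisj A k L (hrest L le_rfl)
    refine ⟨Fin.cons K g, ?_, ?_, ?_⟩
    · rw [Fin.forall_fin_succ]
      exact ⟨by simpa using hK, fun i => by simpa using (hg1 i).trans hL⟩
    · rw [Fin.forall_fin_succ]
      exact ⟨by simpa using hA, fun i => by simpa using hg2 i⟩
    · rw [Fin.forall_fin_succ]
      refine ⟨?_, ?_⟩
      · rw [Fin.forall_fin_succ]
        refine ⟨fun h => absurd rfl h, fun i _ => ?_⟩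
        simp only [Fin.cons_zero, Fin.cons_succ]
        exact Finset.disjoint_of_subset_right (hg1 i) hKL
      · intro i
        rw [Fin.forall_fin_succ]
        refine ⟨fun _ => ?_, fun i' h => ?_⟩
        · simp only [Fin.cons_zero, Fin.cons_succ]
          exact (Finset.disjoint_of_subset_right (hg1 i) hKL).symm
        · simp only [Fin.cons_succ]
          exact hg3 i i' (fun h' => h (by rw [h']))

open Classical in
/-- **Every source of the row STEP(0, j+1) has at least `j+1` distinct targets below it** (the
singleton case of the `(j+1)`-fold SUBSET Hall condition of MINE-B.md §17.2): if `γ ⊆ Y` has red flow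
`0` (`¬ pinFlow O 1 (Y ∖ γ)`) and blue flow `≥ j+1`, then at least `j+1` configurations `γ' ⊆ γ` have
red flow exactly `1` and blue flow `≥ j`.  The witnesses are `γ ∖ τ_i`, `τ_i` the tail of the `i`-th
blue witness after its crossing edge of the red cluster of `s`. -/
theorem source_has_succ_targets (ends : E → Sym2 V) (s t : V) (O Y : Finset E) (j : ℕ)
    {γ : Finset E} (hγY : γ ⊆ Y)
    (hR : ¬ pinFlow ends s t O 1 (Y \ γ)) (hB : pinFlow ends s t O (j + 1) γ) :
    j + 1 ≤ (Y.powerset.filter (fun γ' => γ' ⊆ γ ∧ pinFlow ends s t O 1 (Y \ γ') ∧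
        ¬ pinFlow ends s t O 2 (Y \ γ') ∧ pinFlow ends s t O j γ')).card := by
  -- the red cluster of `s`
  set S : Set V := cluster ends (ofFinset (O ∪ (Y \ γ))) s with hSdef
  have hs : s ∈ S := mem_cluster_self _ _ _
  have ht : t ∉ S := by
    intro h
    apply hR
    rw [pinFlow_one_iff]
    exact h
  -- no red edge crosses the red cluster
  have hred : ∀ e ∈ O ∪ (Y \ γ), ¬ Crosses ends S e := by
    rintro e he ⟨u, v, huv, hu, hv⟩
    apply hv
    have hadj : OpenAdj ends (ofFinset (O ∪ (Y \ γ))) u v := ⟨e, ofFinset_eq_true_iff.2 he, huv⟩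
    by_cases huv' : u = v
    · exact huv' ▸ hu
    · exact mem_cluster_of_adj hu (openGraph_adj.2 ⟨huv', hadj⟩)
  -- the `j+1` disjoint blue witnesses
  obtain ⟨f, hfX, hfA, hfdisj⟩ := family_of_kDisj _ (j + 1) (O ∪ γ) hB
  have hcross : ∀ i, ∃ e ∈ f i, Crosses ends S e ∧ ∃ u ∈ S,
      Carries ends (insert e ((f i).filter (fun g => Outside ends S g))) u t :=
    fun i => exists_crossing_of_carries ends S hs ht (hfA i (f i) le_rfl)
  choose e he hecross u hu htail using hcross
  -- the tails and the targets
  set τ : Fin (j + 1) → Finset E :=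
    fun i => insert (e i) ((f i).filter (fun g => Outside ends S g)) with hτdef
  set γ' : Fin (j + 1) → Finset E := fun i => γ \ τ i with hγ'def
  have hτf : ∀ i, τ i ⊆ f i := fun i => Finset.insert_subset (he i) (Finset.filter_subset _ _)
  have heγ : ∀ i, e i ∈ γ := by
    intro i
    rcases Finset.mem_union.1 (hfX i (he i)) with h1 | h1
    · exact absurd (hecross i) (hred _ (Finset.mem_union_left _ h1))
    · exact h1
  have heτ : ∀ i, e i ∈ τ i := fun i => Finset.mem_insert_self _ _
  -- the targets are pairwise distinct: `e i` is red in `γ' i` and blue in `γ' k`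
  have hinj : Function.Injective γ' := by
    intro i k hik
    by_contra hne
    have h1 : e i ∉ γ' i := fun h => (Finset.mem_sdiff.1 h).2 (heτ i)
    have h2 : e i ∈ γ' k := by
      refine Finset.mem_sdiff.2 ⟨heγ i, fun h => ?_⟩
      exact Finset.disjoint_left.1 (hfdisj i k hne) (he i) (hτf k h)
    rw [hik] at h1
    exact h1 h2
  -- every `γ' i` is a target below `γ`
  have hmem : ∀ i, γ' i ∈ Y.powerset.filter (fun γ' => γ' ⊆ γ ∧ pinFlow ends s t O 1 (Y \ γ') ∧
      ¬ pinFlow ends s t O 2 (Y \ γ') ∧ pinFlow ends s t O j γ') := by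
    intro i
    rw [Finset.mem_filter, Finset.mem_powerset]
    have hsub : γ' i ⊆ γ := Finset.sdiff_subset
    have hredsub : Y \ γ ⊆ Y \ γ' i := Finset.sdiff_subset_sdiff le_rfl hsub
    refine ⟨hsub.trans hγY, hsub, ?_, ?_, ?_⟩
    · -- red flow `≥ 1`: `s ⇝ u i` inside the red cluster, then the tail
      rw [pinFlow_one_iff]
      show Carries ends (O ∪ (Y \ γ' i)) s t
      have h1 : Carries ends (O ∪ (Y \ γ' i)) s (u i) :=
        conn_mono (ofFinset_mono (Finset.union_subset_union_right hredsub)) (hu i)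
      have h2 : Carries ends (O ∪ (Y \ γ' i)) (u i) t := by
        refine (htail i).mono ?_
        intro g hg
        rcases Finset.mem_union.1 (hfX i (hτf i hg)) with h3 | h3
        · exact Finset.mem_union_left _ h3
        · exact Finset.mem_union_right _ (Finset.mem_sdiff.2 ⟨hγY h3,
            fun h4 => (Finset.mem_sdiff.1 h4).2 hg⟩)
      exact conn_trans h1 h2
    · -- red flow `< 2`: the only red crossing edge of `S` is `e i`
      refine not_kDisj_two_of_single_crossing ends S hs ht (X := O ∪ (Y \ γ' i)) (e := e i) ?_
      intro g hg hgc
      rcases Finset.mem_union.1 hg with h1 | h1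
      · exact absurd hgc (hred g (Finset.mem_union_left _ h1))
      · rw [Finset.mem_sdiff] at h1
        by_cases hgγ : g ∈ γ
        · have hgτ : g ∈ τ i := by
            by_contra hgτ
            exact h1.2 (Finset.mem_sdiff.2 ⟨hgγ, hgτ⟩)
          rcases Finset.mem_insert.1 hgτ with h3 | h3
          · exact h3
          · exact absurd (Finset.mem_filter.1 h3).2 (not_outside_of_crosses hgc)
        · exact absurd hgc (hred g (Finset.mem_union_right _ (Finset.mem_sdiff.2 ⟨h1.1, hgγ⟩)))
    · -- blue flow `≥ j`: the other `j` witnesses avoid the tail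
      refine kDisj_of_family _ j (O ∪ γ' i) (fun k => f (i.succAbove k)) ?_ ?_ ?_
      · intro k g hg
        rcases Finset.mem_union.1 (hfX _ hg) with h1 | h1
        · exact Finset.mem_union_left _ h1
        · refine Finset.mem_union_right _ (Finset.mem_sdiff.2 ⟨h1, fun hτ => ?_⟩)
          exact Finset.disjoint_left.1 (hfdisj i (i.succAbove k) (Fin.succAbove_ne i k).symm)
            (hτf i hτ) hg
      · intro k
        exact hfA _
      · intro k k' hkk'
        exact hfdisj _ _ (fun h => hkk' (Fin.succAbove_right_injective h))
  -- conclude by counting the image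
  calc j + 1 = (Finset.univ.image γ').card := by
        rw [Finset.card_image_of_injective _ hinj, Finset.card_univ, Fintype.card_fin]
    _ ≤ _ := Finset.card_le_card (fun x hx => by
        obtain ⟨i, _, rfl⟩ := Finset.mem_image.1 hx
        exact hmem i)

end StepZero

end Summit.Ventures.PercRepro2
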